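import Summits.Langlands.Langlands.Theorems.ParityBlindBianchiTwoAdicBianchiProModularityLevelSqueezeDefs
import HarnessLib

/-!
# Route `ParityBlindBianchi`, crux `TwoAdicBianchiProModularityLevel` (stmt-Langlands-15110), line
# `dimension-squeeze`: the type-`θ` locus `R ⧸ I^θ` is reduced and `2`-torsion-free

Registered sub-goal `squeeze_typeLocus_reduced_torsionFree` of the checked skeleton
`Cruxes/TwoAdicBianchiProModularityLevel/Lines/dimension_squeeze.lean` (v2) — what the v2 reshape of the Galois
half `stub_galoisDomain` (GAL) buys over the naive typed quotient `R ⧸ I_θ`: the type LOCUS ideal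
`I^θ = typeLocusIdeal = ⨅_{φ type-θ} ker φ` is the ideal of the Zariski closure of the characteristic-`0`
type-`θ` points, so `R ⧸ I^θ ↪ ∏_φ 𝒪_{ℚ̄₂}` (`Model.typeLocus_quotient_injective`) is reduced and has no
`2`-torsion (Kisin's reduced, `p`-torsion-free typed quotient).  Vocabulary is the landed Defs file
`ParityBlindBianchiTwoAdicBianchiProModularityLevelSqueezeDefs.lean`; nothing is assumed.

* `two_ne_zero_O2` — `2 ≠ 0` in `𝒪_{ℚ̄₂}`;
* `Model.mem_typeLocusIdeal_iff` — `r ∈ I^θ ↔ φ(r) = 0` for every type-`θ` point `φ`;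
* `Model.typeLocus_quotient_injective` — the evaluation map `R ⧸ I^θ → ∏_φ 𝒪_{ℚ̄₂}` is injective;
* `squeeze_typeLocus_reduced_torsionFree` — `IsReduced (R ⧸ I^θ)` and `2x = 0 ⇒ x = 0` in `R ⧸ I^θ`.

References: M. Kisin, *Moduli of finite flat group schemes, and modularity*, Ann. of Math. 170 (2009), §2.3
(the reduced `𝒪`-flat quotients `R^{τ}` cut out by their `Ē`-points) [cite: KisinModuli2009, §2.3].
-/

noncomputable section

set_option linter.dupNamespace false -- `Summit.Langlands.Langlands` is the mandated namespace (D-0017)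

open scoped NumberField MatrixGroups
open IsDedekindDomain Field
open Literature.NumberTheory.GaloisRepresentations

namespace Summit.Langlands.Langlands.Cruxes.TwoAdicBianchiProModularityLevel.DimensionSqueeze

/-! ### The type locus is reduced and `2`-torsion-free -/

/-- `2 ≠ 0` in `𝒪_{ℚ̄₂}` (a subring of the characteristic-`0` field `ℚ̄₂`). [folklore] -/
theorem two_ne_zero_O2 : (2 : O2) ≠ 0 := by
  intro h
  have h' := congrArg O2.incl h
  rw [map_ofNat, map_zero] at h'
  exact two_ne_zero h'

namespace Model

variable {K : Type} [Field K] [NumberField K] {σ : FramedGaloisRep K (PadicAlgCl 2) 2} (M : Model σ)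
  {S₀ : Finset ℕ} {h0 : (0 : ℕ) ∉ S₀} {h2 : 2 ∈ S₀}
  {hunr : ∀ v ∉ badSet K S₀, Deformation.IsUnramifiedAt v M.residual}

/-- Membership in the type locus ideal: vanishing at every type-`θ` point. [folklore] -/
theorem mem_typeLocusIdeal_iff (𝓡 : PolarizedDeformationRing (M.datum S₀ h0 h2 hunr)) (r : 𝓡.R) :
    r ∈ M.typeLocusIdeal 𝓡 ↔ ∀ φ ∈ M.typePoints 𝓡, φ r = 0 := by
  simp only [typeLocusIdeal, Ideal.mem_iInf, RingHom.mem_ker]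

/-- **`R ⧸ I^θ` embeds in a product of copies of `𝒪_{ℚ̄₂}`**: the evaluation map
`R ⧸ I^θ → ∏_{φ type-θ} 𝒪_{ℚ̄₂}` is an injective ring homomorphism (the kernel of `∏ φ` is
`⨅ ker φ = I^θ` by definition). [cite: KisinModuli2009, §2.3] -/
theorem typeLocus_quotient_injective (𝓡 : PolarizedDeformationRing (M.datum S₀ h0 h2 hunr)) :
    Function.Injective
      (Ideal.Quotient.lift (M.typeLocusIdeal 𝓡)
        (RingHom.pi fun φ : M.typePoints 𝓡 => (φ : 𝓡.R →+* O2))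
        (fun r hr => funext fun φ => (M.mem_typeLocusIdeal_iff 𝓡 r).mp hr φ φ.2)) := by
  rw [RingHom.injective_iff_ker_eq_bot, RingHom.ker_eq_bot_iff_eq_zero]
  intro x hx
  obtain ⟨r, rfl⟩ := Ideal.Quotient.mk_surjective x
  rw [Ideal.Quotient.lift_mk] at hx
  rw [Ideal.Quotient.eq_zero_iff_mem, M.mem_typeLocusIdeal_iff]
  intro φ hφ
  exact congrFun hx ⟨φ, hφ⟩

end Model

/-- REGISTERED SUB-GOAL `squeeze_typeLocus_reduced_torsionFree` (what v2 buys over the naive typed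
quotient `R ⧸ I_θ`): **the type-`θ` locus `R ⧸ I^θ` is reduced and `2`-torsion-free** — it embeds in
`∏_φ 𝒪_{ℚ̄₂}`, a product of characteristic-`0` domains (`Model.typeLocus_quotient_injective`); directly:
`r^n ∈ ⨅ ker φ ⇒ φ(r)^n = 0 ⇒ φ(r) = 0`, and `2r ∈ ⨅ ker φ ⇒ 2 φ(r) = 0 ⇒ φ(r) = 0` as `2 ≠ 0` in
`𝒪_{ℚ̄₂}`. [cite: KisinModuli2009, §2.3] -/
theorem squeeze_typeLocus_reduced_torsionFree : ∀ (K : Type) [Field K] [NumberField K]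
    (σ : FramedGaloisRep K (PadicAlgCl 2) 2) (M : Model σ) (S₀ : Finset ℕ) (h0 : (0 : ℕ) ∉ S₀) (h2 : 2 ∈ S₀)
    (hunr : ∀ v ∉ badSet K S₀, Deformation.IsUnramifiedAt v M.residual)
    (𝓡 : PolarizedDeformationRing (M.datum S₀ h0 h2 hunr)),
    IsReduced (𝓡.R ⧸ M.typeLocusIdeal 𝓡) ∧ ∀ x : 𝓡.R ⧸ M.typeLocusIdeal 𝓡, 2 * x = 0 → x = 0 := by
  intro K _ _ σ M S₀ h0 h2 hunr 𝓡
  constructor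
  · refine (Ideal.isRadical_iff_quotient_reduced _).mp fun r hr => ?_
    obtain ⟨n, hn⟩ := hr
    rw [M.mem_typeLocusIdeal_iff] at hn ⊢
    intro φ hφ
    exact IsNilpotent.eq_zero ⟨n, by rw [← map_pow]; exact hn φ hφ⟩
  · intro x hx
    obtain ⟨r, rfl⟩ := Ideal.Quotient.mk_surjective x
    have hr : Ideal.Quotient.mk (M.typeLocusIdeal 𝓡) (2 * r) = 0 := by rw [map_mul, map_ofNat]; exact hx
    rw [Ideal.Quotient.eq_zero_iff_mem, M.mem_typeLocusIdeal_iff] at hr ⊢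
    intro φ hφ
    have h2r := hr φ hφ
    rw [map_mul, map_ofNat] at h2r
    exact (mul_eq_zero.mp h2r).resolve_left two_ne_zero_O2

end Summit.Langlands.Langlands.Cruxes.TwoAdicBianchiProModularityLevel.DimensionSqueeze

end
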